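import Summits.Ventures.Crystal3D.Theorems.StickyWulffConstantTextureBuildLawData
import Summits.Ventures.Crystal3D.Theorems.StickyWulffConstantTextureBuildWallBodySupport
import Summits.Ventures.Crystal3D.Theorems.StickyWulffConstantTextureBuildSlabPieces
import Summits.Ventures.Crystal3D.Theorems.StickyWulffConstantTextureLiminfTexShadowBilayerFrameRigidity
import HarnessLib

/-!
# TB-D assembly, part 8b: the WALL WEIGHT of the texture — bounds, zero on shared axes, and domination by a wall cell's law table
# (lane T, crux `TextureLiminfV5`, stmt-Ventures-23912; repair census HOME/wulff-p2/g20/TB-D-1-g20.md §2 (b), (C3), (R2); brick B4)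

HONEST FRAMING. Venture `Summits/Ventures/Crystal3D` (cell `crystal3d-full`), route `route-Ventures-StickyWulffConstant`, helper `--supports` the
law-v5 crux `TextureLiminfV5` (stmt-Ventures-23912).  One small DEFINITION (the weight) + frame algebra (census-free, standard axioms); F-C1 not moved.

The piece ledger of the `PieceData` texture charges a contact between slab grains `ℓ, ℓ'` across a facet with unit normal `ν` at the WEIGHT
`lawW A ℓ ℓ' ν := lawC A ℓ ℓ' / 2 · h_{wallBody (lawM A ℓ ℓ')}(ν)` (…TextureBuildLawData p712144: the cheapest data the law `IsTexture (13/25) (1/2)`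
allows).  This file supplies what the ledger splitting (parts 7b/7c) and the census rows consume:
* `lawW_nonneg`, `lawW_le` (`≤ 13/50` on unit vectors) — the `w ≥ 0`, `w ≤ κc/2` inputs of `wall_le_split` with `κc = 13/25`;
* `sharedAxis_trans` / `coAx_trans_iff` / `image_fccRef_trans` — transport of the frame predicates under a rigid motion (cell model → actual position);
* **`lawW_eq_zero_of_sharedAxis`** — a contact across a plane whose unit normal is (up to sign) a SHARED STACKING AXIS of the two frames is FREE: equal
  lattices give `lawC = 0`, distinct co-axial lattices have a unique axis up to sign (`coaxial_axis_eq_or_eq_neg`) and `h_{D(m)}(±m) = 0`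
  (…TextureBuildWallBodySupport p709816).  This is the zero behind ALL same-grain contacts (layer planes of one presentation), the riser boxes' mid-slab
  planes and the co-axial agreement contacts (census rows (b), (R2), (A1));
* **`lawC_mul_supportFn_le_cell`** — CELL-TABLE DOMINATION (census (C3)): if the placed bilayer frames of a wall cell carry the lattices of the two slab
  grains, the texture's cut cost density `lawC·h_{D(lawM)}(±M e₃)` is at most the cell's full table entry `c` (`Mesh₃.hlaw`'s two clauses + the shared
  axis of the cell's own `m` from `BilayerChargeAdmissibleAt`).
-/

noncomputable section

namespace Summit.Ventures.Crystal3D.Cruxes.TextureLiminf.TexShadow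

open Summit.Ventures.Crystal3D Summit.Ventures.Crystal3D.Theorems Set
open scoped InnerProductSpace
open Literature.MathematicalPhysics.StatisticalMechanics (barlowStacking IsHaggSeq)

/-! ### Transport under a rigid motion -/

/-- The lattice of a composed frame. -/
theorem image_fccRef_trans (A M : E3 ≃ₗᵢ[ℝ] E3) : (A.trans M) '' fccRef = M '' (A '' fccRef) := by
  rw [Set.image_image]; rfl

/-- A shared axis is transported by a rigid motion. -/
theorem sharedAxis_trans {m : E3} {A B : E3 ≃ₗᵢ[ℝ] E3} (M : E3 ≃ₗᵢ[ℝ] E3) (h : SharedAxis m A B) :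
    SharedAxis (M m) (A.trans M) (B.trans M) := by
  obtain ⟨L, s₁, s₂, σ, σ', hσ, hσ', hLe, hA, hB⟩ := h
  refine ⟨L.trans M, M s₁, M s₂, σ, σ', hσ, hσ', by simp [hLe], ?_, ?_⟩
  · rw [image_fccRef_trans]
    rintro _ ⟨y, hy, rfl⟩
    obtain ⟨q, hq, rfl⟩ := hA hy
    exact ⟨q, hq, by simp [map_add]⟩
  · rw [image_fccRef_trans]
    rintro _ ⟨y, hy, rfl⟩
    obtain ⟨q, hq, rfl⟩ := hB hy
    exact ⟨q, hq, by simp [map_add]⟩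

/-- `(A.trans M).trans M.symm = A` on lattices. -/
theorem trans_trans_symm (A M : E3 ≃ₗᵢ[ℝ] E3) : (A.trans M).trans M.symm = A := by
  ext x; simp

/-- Co-axiality is invariant under a rigid motion. -/
theorem coAx_trans_iff {A B : E3 ≃ₗᵢ[ℝ] E3} (M : E3 ≃ₗᵢ[ℝ] E3) : CoAx (A.trans M) (B.trans M) ↔ CoAx A B := by
  constructor
  · rintro ⟨m, hm⟩
    have h := sharedAxis_trans M.symm hm
    rw [trans_trans_symm, trans_trans_symm] at h
    exact ⟨_, h⟩
  · rintro ⟨m, hm⟩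
    exact ⟨_, sharedAxis_trans M hm⟩

/-- Lattice equality is invariant under a rigid motion. -/
theorem image_fccRef_trans_eq_iff {A B : E3 ≃ₗᵢ[ℝ] E3} (M : E3 ≃ₗᵢ[ℝ] E3) :
    (A.trans M) '' fccRef = (B.trans M) '' fccRef ↔ A '' fccRef = B '' fccRef := by
  rw [image_fccRef_trans, image_fccRef_trans, (M.injective.image_injective).eq_iff]

/-- A shared axis is a unit vector. -/
theorem norm_eq_one_of_sharedAxis {m : E3} {A B : E3 ≃ₗᵢ[ℝ] E3} (h : SharedAxis m A B) : ‖m‖ = 1 := by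
  obtain ⟨L, -, -, -, -, -, -, hLe, -, -⟩ := h
  rw [← hLe]; exact norm_frame_e₃ L

/-- Two shared axes of frames with DIFFERENT lattices agree up to sign. -/
theorem sharedAxis_eq_or_eq_neg {m m' : E3} {A B : E3 ≃ₗᵢ[ℝ] E3} (h : SharedAxis m A B) (h' : SharedAxis m' A B)
    (hne : A '' fccRef ≠ B '' fccRef) : m' = m ∨ m' = -m :=
  coaxial_axis_eq_or_eq_neg h h' hne

/-! ### The weight -/

/-- the texture's wall WEIGHT across a facet with normal `ν`: `lawC/2 · h_{wallBody lawM}(ν)`. -/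
def lawW {ι : Type*} (A : ι → (E3 ≃ₗᵢ[ℝ] E3)) (ℓ ℓ' : ι) (ν : E3) : ℝ :=
  lawC A ℓ ℓ' / 2 * supportFn (wallBody (lawM A ℓ ℓ')) ν

variable {ι : Type*} (A : ι → (E3 ≃ₗᵢ[ℝ] E3))

/-- Support functions of wall bodies are nonnegative. -/
theorem supportFn_wallBody_nonneg (m ν : E3) : 0 ≤ supportFn (wallBody m) ν := by
  unfold supportFn wallBody
  simpa using le_csSup (bddAbove_disc_inner m ν) ⟨0, zero_mem_disc m, by simp⟩

/-- Support functions of wall bodies are at most the norm. -/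
theorem supportFn_wallBody_le_norm (m ν : E3) : supportFn (wallBody m) ν ≤ ‖ν‖ := supportFn_disc_le_norm m ν

/-- `lawW ≥ 0`. -/
theorem lawW_nonneg (ℓ ℓ' : ι) (ν : E3) : 0 ≤ lawW A ℓ ℓ' ν :=
  mul_nonneg (div_nonneg (lawC_nonneg A ℓ ℓ') (by norm_num)) (supportFn_wallBody_nonneg _ _)

/-- `lawW ≤ (13/25)/2` on unit vectors. -/
theorem lawW_le (ℓ ℓ' : ι) {ν : E3} (hν : ‖ν‖ = 1) : lawW A ℓ ℓ' ν ≤ 13 / 25 / 2 := by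
  unfold lawW
  have h1 : supportFn (wallBody (lawM A ℓ ℓ')) ν ≤ 1 := (supportFn_wallBody_le_norm _ _).trans hν.le
  have h2 : lawC A ℓ ℓ' / 2 ≤ 13 / 25 / 2 := by linarith [lawC_le A ℓ ℓ']
  calc lawC A ℓ ℓ' / 2 * supportFn (wallBody (lawM A ℓ ℓ')) ν ≤ lawC A ℓ ℓ' / 2 * 1 :=
        mul_le_mul_of_nonneg_left h1 (div_nonneg (lawC_nonneg A ℓ ℓ') (by norm_num))
    _ ≤ 13 / 25 / 2 := by linarith

/-- `c/2 · Σ_p h·area = Σ_p lawW·area` — the rewriting between `PieceData.hledger`'s wall line and `wall_le_split`'s. -/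
theorem lawC_div_two_mul_sum {α : Type*} (s : Finset α) (ℓ ℓ' : ι) (nrm : α → E3) (ar : α → ℝ) :
    lawC A ℓ ℓ' / 2 * ∑ p ∈ s, supportFn (wallBody (lawM A ℓ ℓ')) (nrm p) * ar p = ∑ p ∈ s, lawW A ℓ ℓ' (nrm p) * ar p := by
  rw [Finset.mul_sum]
  refine Finset.sum_congr rfl fun p _ => ?_
  unfold lawW; ring

/-! ### Zero weight across a shared axis -/

/-- `h_{wallBody m}(m) = 0` and `h_{wallBody m}(−m) = 0` (from …TextureBuildWallBodySupport). -/
theorem supportFn_wallBody_self (m : E3) : supportFn (wallBody m) m = 0 := supportFn_disc_self m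

/-- The opposite direction. -/
theorem supportFn_wallBody_neg_self (m : E3) : supportFn (wallBody m) (-m) = 0 := supportFn_disc_neg_self m

/-- `wallBody (−m) = wallBody m`. -/
theorem wallBody_neg (m : E3) : wallBody (-m) = wallBody m := by
  ext y; simp [wallBody, inner_neg_right]

/-- **A contact across a shared stacking axis is free**: if `ν` is a shared axis of the frames `A ℓ`, `A ℓ'`, then `lawW A ℓ ℓ' ν = 0` and
`lawW A ℓ ℓ' (−ν) = 0`. -/
theorem lawW_eq_zero_of_sharedAxis {ℓ ℓ' : ι} {ν : E3} (hν : SharedAxis ν (A ℓ) (A ℓ')) :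
    lawW A ℓ ℓ' ν = 0 ∧ lawW A ℓ ℓ' (-ν) = 0 := by
  unfold lawW
  by_cases heq : A ℓ '' fccRef = A ℓ' '' fccRef
  · rw [lawC_of_eq A heq]; simp
  · have hco : CoAx (A ℓ) (A ℓ') := ⟨ν, hν⟩
    have hm := sharedAxis_lawM A hco heq
    rcases sharedAxis_eq_or_eq_neg hν hm heq with h | h
    · rw [h, supportFn_wallBody_self, supportFn_wallBody_neg_self]; simp
    · rw [h, wallBody_neg, supportFn_wallBody_self, supportFn_wallBody_neg_self]; simp

/-- The same in product form `lawC · h = 0`. -/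
theorem lawC_mul_supportFn_eq_zero_of_sharedAxis {ℓ ℓ' : ι} {ν : E3} (hν : SharedAxis ν (A ℓ) (A ℓ')) :
    lawC A ℓ ℓ' * supportFn (wallBody (lawM A ℓ ℓ')) ν = 0 ∧ lawC A ℓ ℓ' * supportFn (wallBody (lawM A ℓ ℓ')) (-ν) = 0 := by
  have h := lawW_eq_zero_of_sharedAxis A hν
  unfold lawW at h
  constructor <;> nlinarith [h.1, h.2]

/-! ### Domination by a wall cell's law table -/

/-- `h_{wallBody m}(ν) ≤ √(1 − ⟪m, ν⟫²)` for unit `m, ν` (from …TextureBuildWallBodySupport). -/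
theorem supportFn_wallBody_le_sqrt {m ν : E3} (hm : ‖m‖ = 1) (hν : ‖ν‖ = 1) :
    supportFn (wallBody m) ν ≤ Real.sqrt (1 - ⟪m, ν⟫_ℝ ^ 2) := by
  rw [real_inner_comm]; exact supportFn_disc_le_sqrt_one_sub hm hν

/-- **CELL-TABLE DOMINATION.**  Slab grains `ℓ, ℓ'` with frames `A ℓ, A ℓ'`; a wall cell placed by the rigid motion `M` whose bilayer frames `A₁, A₂`
(model position) carry, once placed, the two grains' lattices; the cell's table entry `c ≥ 0` with the FULL-law clauses (`Mesh₃.hlaw`) and its own axis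
`mk` shared whenever the cell frames are co-axial and distinct (`BilayerChargeAdmissibleAt`).  Then across the cut plane (unit normal `±M e₃`) the
texture's cost density is at most `c`: `lawC A ℓ ℓ' · h_{wallBody (lawM A ℓ ℓ')}(±M e₃) ≤ c`. -/
theorem lawC_mul_supportFn_le_cell {ℓ ℓ' : ι} {A₁ A₂ M : E3 ≃ₗᵢ[ℝ] E3} {c : ℝ} {mk : E3}
    (h₁ : (A₁.trans M) '' fccRef = A ℓ '' fccRef) (h₂ : (A₂.trans M) '' fccRef = A ℓ' '' fccRef) (hc0 : 0 ≤ c)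
    (hlaw₁ : ¬ CoAx A₁ A₂ → (13 / 25 : ℝ) ≤ c)
    (hlaw₂ : CoAx A₁ A₂ → A₁ '' fccRef ≠ A₂ '' fccRef → 1 / 2 * Real.sqrt (1 - ⟪mk, e₃⟫_ℝ ^ 2) ≤ c)
    (hmk : CoAx A₁ A₂ → A₁ '' fccRef ≠ A₂ '' fccRef → SharedAxis mk A₁ A₂)
    {ν : E3} (hν : ν = M e₃ ∨ ν = -M e₃) :
    lawC A ℓ ℓ' * supportFn (wallBody (lawM A ℓ ℓ')) ν ≤ c := by
  have hνn : ‖ν‖ = 1 := by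
    rcases hν with rfl | rfl
    · exact norm_frame_e₃ M
    · rw [norm_neg]; exact norm_frame_e₃ M
  have hh1 : supportFn (wallBody (lawM A ℓ ℓ')) ν ≤ 1 := (supportFn_wallBody_le_norm _ _).trans hνn.le
  have hh0 : 0 ≤ supportFn (wallBody (lawM A ℓ ℓ')) ν := supportFn_wallBody_nonneg _ _
  by_cases heq : A ℓ '' fccRef = A ℓ' '' fccRef
  · rw [lawC_of_eq A heq, zero_mul]; exact hc0
  · -- the cell frames have distinct lattices too, and the same co-axiality as the grains
    have hne12 : A₁ '' fccRef ≠ A₂ '' fccRef := by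
      intro h
      apply heq
      rw [← h₁, ← h₂, image_fccRef_trans, image_fccRef_trans, h]
    have hco_iff : CoAx (A ℓ) (A ℓ') ↔ CoAx A₁ A₂ := by
      rw [← coAx_congr h₁ h₂, coAx_trans_iff]
    by_cases hco : CoAx (A ℓ) (A ℓ')
    · -- co-axial, distinct: `lawC = 1/2`, `lawM = ±(M mk)`
      have hco12 : CoAx A₁ A₂ := hco_iff.1 hco
      rw [lawC_of_coAx_ne A hco heq]
      have hmT : SharedAxis (lawM A ℓ ℓ') (A ℓ) (A ℓ') := sharedAxis_lawM A hco heq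
      have hmk' : SharedAxis (M mk) (A ℓ) (A ℓ') := by
        rw [← sharedAxis_congr h₁ h₂]
        exact sharedAxis_trans M (hmk hco12 hne12)
      have hmkn : ‖mk‖ = 1 := norm_eq_one_of_sharedAxis (hmk hco12 hne12)
      have hMmkn : ‖M mk‖ = 1 := by rw [LinearIsometryEquiv.norm_map, hmkn]
      have hsq : ⟪lawM A ℓ ℓ', ν⟫_ℝ ^ 2 = ⟪mk, e₃⟫_ℝ ^ 2 := by
        have hinner : ⟪M mk, ν⟫_ℝ ^ 2 = ⟪mk, e₃⟫_ℝ ^ 2 := by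
          rcases hν with rfl | rfl
          · rw [LinearIsometryEquiv.inner_map_map]
          · rw [inner_neg_right, LinearIsometryEquiv.inner_map_map, neg_sq]
        rcases sharedAxis_eq_or_eq_neg hmk' hmT heq with h | h
        · rw [h, hinner]
        · rw [h, inner_neg_left, neg_sq, hinner]
      have hmTn : ‖lawM A ℓ ℓ'‖ = 1 := norm_eq_one_of_sharedAxis hmT
      have hle := supportFn_wallBody_le_sqrt hmTn hνn
      rw [hsq] at hle
      calc 1 / 2 * supportFn (wallBody (lawM A ℓ ℓ')) ν ≤ 1 / 2 * Real.sqrt (1 - ⟪mk, e₃⟫_ℝ ^ 2) :=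
            mul_le_mul_of_nonneg_left hle (by norm_num)
        _ ≤ c := hlaw₂ hco12 hne12
    · -- not co-axial: `lawC = 13/25`, `h ≤ 1`
      rw [lawC_of_not_coAx A hco]
      have h13 : (13 / 25 : ℝ) ≤ c := hlaw₁ (fun h => hco (hco_iff.2 h))
      nlinarith

end Summit.Ventures.Crystal3D.Cruxes.TextureLiminf.TexShadow

end
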